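import Literature.Analysis.FluidPDE.VortexFilament.CurlEnergyMain
import Literature.Analysis.FluidPDE.VortexFilament.SelfEnergy
import Literature.Analysis.FluidPDE.VorticityCalculus

/-!
# Proof of the Jerrard–Seis kinetic-energy lower bound for concentrated vorticity

Discharge of the named fact
`Literature.Analysis.FluidPDE.VortexFilament.JerrardSeis2016_filamentEnergyLowerBound`
(file `VortexFilamentEnergy.lean`): Theorem 1, first assertion, of R. L. Jerrard, C. Seis,
*On the vortex filament conjecture for Euler flows*, ARMA 224 (2017) 135–172 = arXiv:1603.00227
[JerrardSeis2016], in the unwound form (13): for a closed Lipschitz curve of length `L` with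
`‖κ*‖_{L^{1,∞}} ≤ K`, `0 < ε < L/2`, and `u ∈ L²` with `‖∇ × u − μ_Γ‖_F ≤ εL`,
`∫ ½|u|² ≥ L log(L/ε)/(4π) − C K² L` with an absolute constant `C`.

## Proof

The paper (§4.3) compares `u` with the prototype field `v^ε = ∇ × Φ^ε`,
`Φ^ε = G ∗ ρ^ε ∗ μ_Γ`, through `∫ |u − v^ε|² ≥ 0`, the flat-norm duality
`|∫ v^ε · (v^ε − u)| ≤ ‖∇ × (χΦ^ε)‖_∞ ‖∇ × u − ∇ × v^ε‖_F ≲ ‖κ*‖`, and the self-energy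
`‖v^ε‖² = |log ε|/(2π) + O(‖κ*‖²)`. We run the same mechanism in dual form with an explicit
potential: `ξ = F ∗ μ_Γ` where `F` is the capped, cut-off Newtonian kernel at scales `ε`,
`R = L` (`Kernel.lean`, `TestField.lean`). Testing the flat hypothesis against `−ξ/M`,
`M = ‖curl ξ‖_∞ ≤ C K/ε` (Lemma 4 of the paper, `Curve.lean`), gives
`∫ u · curl ξ ≥ T − C₁ K L`, `T = ∫ ξ · dμ_Γ`; Cauchy–Schwarz gives `∫ u · curl ξ ≤ ‖u‖₂‖curl ξ‖₂`;
`‖curl ξ‖₂² ≤ 4πT + C₂ K L` (`CurlEnergy.lean`, `CurlEnergyMain.lean`: integration by parts and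
the flux identity `∫(−ΔF) = 4π`); and `T ≥ 2L log(L/ε) − 49 K L` (`SelfEnergy.lean`). Hence
`‖u‖₂² ≥ (T − C₁KL)²/(4πT + C₂KL) ≥ T/(4π) − O(KL) ≥ L log(L/ε)/(2π) − O(KL)`. All constants
are absolute because the kernel profiles are fixed (`Profiles.lean`). The divergence-free
hypothesis of the fact is not used (the bound holds for every `u ∈ L²`, as it must: the
gradient part of `u` only increases the energy and does not change the vorticity).
-/

noncomputable section

open MeasureTheory Set Filter Function Metric
open scoped Topology InnerProductSpace RealInnerProductSpace ENNReal NNReal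

namespace Literature.Analysis.FluidPDE

namespace VortexFilament

/-- The line integral is linear in the field: `∫ (c ξ) · dμ_Γ = c ∫ ξ · dμ_Γ`. [folklore] -/
theorem tangentLineIntegral_const_smul (L : ℝ) (γ : ℝ → EuclideanSpace ℝ (Fin 3))
    (ξ : EuclideanSpace ℝ (Fin 3) → EuclideanSpace ℝ (Fin 3)) (c : ℝ) :
    tangentLineIntegral L γ (fun y => c • ξ y) = c * tangentLineIntegral L γ ξ := by
  unfold tangentLineIntegral
  rw [← MeasureTheory.integral_const_mul]
  congr 1; funext s
  exact real_inner_smul_left _ _ _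

/-- Cauchy–Schwarz for the `L²` pairing of a square-integrable field with a bounded compactly
supported continuous field. [folklore] -/
theorem integral_inner_le_sqrt_mul_sqrt {u w : EuclideanSpace ℝ (Fin 3) → EuclideanSpace ℝ (Fin 3)}
    (hu : MemLp u 2 volume) (hwc : Continuous w) (hws : HasCompactSupport w) :
    ∫ x, ⟪u x, w x⟫ ≤ Real.sqrt (∫ x, ‖u x‖ ^ 2) * Real.sqrt (∫ x, ‖w x‖ ^ 2) := by
  have hw : MemLp w 2 volume := hwc.memLp_of_hasCompactSupport hws
  have hu2 : Integrable (fun x => ‖u x‖ ^ 2) := hu.integrable_norm_pow two_ne_zero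
  have hw2 : Integrable (fun x => ‖w x‖ ^ 2) := hw.integrable_norm_pow two_ne_zero
  -- integrability of `‖u‖ ‖w‖`
  have hsum : Integrable fun x => (‖u x‖ ^ 2 + ‖w x‖ ^ 2) / 2 := (hu2.add hw2).div_const 2
  have hprod : Integrable fun x => ‖u x‖ * ‖w x‖ := by
    refine hsum.mono' (hu.1.norm.mul hw.1.norm) (ae_of_all _ fun x => ?_)
    show ‖‖u x‖ * ‖w x‖‖ ≤ (‖u x‖ ^ 2 + ‖w x‖ ^ 2) / 2
    rw [Real.norm_eq_abs, abs_of_nonneg (by positivity)]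
    nlinarith [sq_nonneg (‖u x‖ - ‖w x‖)]
  have h1 : ∫ x, ⟪u x, w x⟫ ≤ ∫ x, ‖u x‖ * ‖w x‖ := by
    refine (le_abs_self _).trans ?_
    rw [← Real.norm_eq_abs]
    exact norm_integral_le_of_norm_le hprod (ae_of_all _ fun x => norm_inner_le_norm _ _)
  have h2 := integral_mul_le_Lp_mul_Lq_of_nonneg (μ := (volume : Measure (EuclideanSpace ℝ (Fin 3))))
    Real.HolderConjugate.two_two (f := fun x => ‖u x‖) (g := fun x => ‖w x‖)
    (ae_of_all _ fun _ => norm_nonneg _) (ae_of_all _ fun _ => norm_nonneg _)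
    (by simpa using hu.norm) (by simpa using hw.norm)
  refine h1.trans (h2.trans_eq ?_)
  simp only [Real.rpow_two, one_div, Real.sqrt_eq_rpow]

/-- **Jerrard–Seis, Theorem 1 (first assertion): discharge.** For every closed oriented
Lipschitz curve of length `L` with `‖κ*‖_{L^{1,∞}} ≤ K`, every `0 < ε < L/2` and every
divergence-free `u ∈ L²(ℝ³; ℝ³)` with `‖∇ × u − μ_Γ‖_F ≤ εL`, one has
`∫ ½|u|² ≥ L log(L/ε)/(4π) − C K² L` with an absolute constant `C`.

Proof (a duality form of the paper's comparison with the prototype field `v^ε`, §4.3): let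
`ξ = F ∗ μ_Γ` be the test field built on the capped cut-off Newtonian kernel at scales `ε`,
`R = L` (`Kernel.lean`, `TestField.lean`). Testing the flat-norm hypothesis against `−ξ/M`,
`M = ‖curl ξ‖_∞ ≲ K/ε` (`norm_curl_testField_le_const`, from Lemma 4), gives
`∫ u · curl ξ ≥ T − C₁ K L` where `T = ∫ ξ · dμ_Γ`; Cauchy–Schwarz gives
`∫ u · curl ξ ≤ ‖u‖₂ ‖curl ξ‖₂`; the curl energy satisfies `‖curl ξ‖₂² ≤ 4π T + C₂ K L`
(`curl_energy_le`: integration by parts and the flux identity `∫(−ΔF) = 4π`), and the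
self-energy bound `T ≥ 2L log(L/ε) − 49 K L` (`tangentLineIntegral_ge`) closes the estimate:
`‖u‖₂² ≥ (T − C₁KL)²/(4πT + C₂KL) ≥ T/(4π) − O(KL)`. The divergence-free hypothesis is not
needed. [cite: JerrardSeis2016, Thm 1 p.8 (first assertion) with §2.4 eqs. (12), (13); proof §4.3] -/
theorem JerrardSeis2016_filamentEnergyLowerBound_holds : JerrardSeis2016_filamentEnergyLowerBound := by
  obtain ⟨C₁, C₂, C₃, hC₁, hC₂, hC₃, hker⟩ := exists_kernel
  -- the three absolute constants of the estimates
  set c₁ : ℝ := 576 * C₁ + 1 with hc₁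
  set c₂ : ℝ := 256 * Real.pi * (2 * C₁) * C₂ + 2 * Real.sqrt 2 * Real.pi * C₃ with hc₂
  have hc₁0 : 0 ≤ c₁ := by positivity
  have hc₂0 : 0 ≤ c₂ := by positivity
  refine ⟨c₁ + c₂ + 49, ?_⟩
  intro L ε γ K u hγ hK hε hεL hu _hdiv hflat
  have hL : 0 < L := hγ.pos
  have h2ε : 2 * ε < L := by linarith
  have hK2 : (2:ℝ) ≤ K := hγ.two_le_of_weakL1Norm_le hK
  have hK0 : (0:ℝ) < K := by linarith
  have hπ : 2 ≤ Real.pi := Real.two_le_pi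
  obtain ⟨F, q₁, q₂, hF2, hq₁, hq₂, hFR, hF0, hFle, hFann, hFanti, hF', hG', hgrad1, hlap_in,
    hlap_mid, hlap_out, -, hflux, hFint, hFL1⟩ := hker ε L hε h2ε
  set ξ : EuclideanSpace ℝ (Fin 3) → EuclideanSpace ℝ (Fin 3) :=
    fun x => ∫ s in Ico 0 L, F (x - γ s) • deriv γ s with hξ
  -- derived kernel facts
  have hF1 : ContDiff ℝ 1 F := hF2.of_le (by norm_num)
  have hFc : Continuous F := hF2.continuous
  have hFs : HasCompactSupport F := by
    refine HasCompactSupport.intro (isCompact_closedBall (0 : EuclideanSpace ℝ (Fin 3)) L) ?_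
    intro z hz
    rw [mem_closedBall_zero_iff, not_le] at hz
    exact hFR z hz.le
  have hgrad : ∀ z : EuclideanSpace ℝ (Fin 3), ‖fderiv ℝ F z‖ ≤ (2 * C₁) * ((max ε ‖z‖)⁻¹) ^ 2 := by
    intro z
    rw [(hF' z).fderiv, norm_smul, innerSL_apply_norm, Real.norm_eq_abs, abs_mul,
      abs_of_pos (by norm_num : (0:ℝ) < 2)]
    have := hgrad1 z
    nlinarith [abs_nonneg (q₁ (‖z‖ ^ 2)), norm_nonneg z]
  -- the test field
  have hξ1 : ContDiff ℝ 1 ξ := contDiff_one_testField hγ hF1 hFs hξ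
  have hξc : Continuous ξ := hξ1.continuous
  have hξs : HasCompactSupport ξ := hasCompactSupport_testField hγ hFR hξ
  have hcurl_bd : ∀ x, ‖curl ξ x‖ ≤ 288 * (2 * C₁) * K / ε := fun x =>
    norm_curl_testField_le_const hγ hK hε (by positivity) hF1 hFs hgrad hξ x
  have hcurlc : Continuous (curl ξ) := by
    have hD : Continuous (fderiv ℝ ξ) := hξ1.continuous_fderiv one_ne_zero
    have hc : ∀ j i, Continuous fun x => fderiv ℝ ξ x (EuclideanSpace.single j 1) i :=
      fun j i => (EuclideanSpace.proj i).continuous.comp (hD.clm_apply continuous_const)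
    unfold curl
    refine (PiLp.continuous_toLp 2 _).comp ?_
    refine continuous_pi fun i => ?_
    fin_cases i <;> simp <;> fun_prop
  have hcurls : HasCompactSupport (curl ξ) := by
    refine (hξs.fderiv ℝ).mono ?_
    intro x hx
    rw [mem_support] at hx ⊢
    contrapose! hx
    unfold curl
    simp [hx]
  -- the three estimates
  set T : ℝ := tangentLineIntegral L γ ξ with hT
  set A : ℝ := ∫ x, ⟪u x, curl ξ x⟫ with hA
  set Q : ℝ := ∫ x, ‖curl ξ x‖ ^ 2 with hQ
  set E' : ℝ := ∫ x, ‖u x‖ ^ 2 with hE'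
  have hQle : Q ≤ 4 * Real.pi * T + c₂ * K * L :=
    curl_energy_le hγ hK hε h2ε (by positivity) hC₂ hC₃ hF2 hq₁ hq₂ hFR hF0 hF' hG' hgrad
      hlap_in hlap_mid hlap_out hflux hFL1 hξ
  have hTge : 2 * L * Real.log (L / ε) - 49 * K * L ≤ T :=
    tangentLineIntegral_ge hγ hK hε hFc hFs hF0 hFle hFann hFanti hξ hξc hξs
  -- the flat-norm hypothesis tested against `−ξ/M`
  set M : ℝ := c₁ * K / ε with hM
  have hM0 : 0 < M := by positivity
  have hcurl_lt : ∀ x, ‖curl ξ x‖ ≤ M := by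
    intro x
    refine (hcurl_bd x).trans ?_
    rw [hM, hc₁]
    rw [div_le_div_iff_of_pos_right hε]
    nlinarith
  have hAge : T - c₁ * K * L ≤ A := by
    set ζ : EuclideanSpace ℝ (Fin 3) → EuclideanSpace ℝ (Fin 3) := fun y => (-M⁻¹) • ξ y with hζ
    have hζtest : IsFlatTestField ζ := by
      refine ⟨hξ1.const_smul _, hξs.comp_left (g := fun v => (-M⁻¹) • v) (smul_zero _), fun x => ?_⟩
      rw [hζ, curl_const_smul ((hξ1.differentiable one_ne_zero) x), norm_smul, norm_neg, norm_inv,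
        Real.norm_eq_abs, abs_of_pos hM0]
      rw [inv_mul_le_iff₀ hM0, mul_one]
      exact hcurl_lt x
    have h := hflat ζ hζtest
    unfold vorticityDefectPairing at h
    have h1 : (∫ x, ⟪u x, curl ζ x⟫) = (-M⁻¹) * A := by
      rw [hA, ← MeasureTheory.integral_const_mul]
      congr 1; funext x
      rw [hζ, curl_const_smul ((hξ1.differentiable one_ne_zero) x), real_inner_smul_right]
    have h2 : tangentLineIntegral L γ ζ = (-M⁻¹) * T := tangentLineIntegral_const_smul L γ ξ _
    rw [h1, h2] at h
    have h3 : M⁻¹ * (T - A) ≤ ε * L := by linarith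
    rw [inv_mul_le_iff₀ hM0] at h3
    have h4 : M * (ε * L) = c₁ * K * L := by rw [hM]; field_simp
    linarith
  -- Cauchy–Schwarz
  have hCS : A ≤ Real.sqrt E' * Real.sqrt Q := integral_inner_le_sqrt_mul_sqrt hu hcurlc hcurls
  have hE'0 : 0 ≤ E' := integral_nonneg fun _ => by positivity
  have hQ0 : 0 ≤ Q := integral_nonneg fun _ => by positivity
  -- the goal is about `½ E'`
  show L * Real.log (L / ε) / (4 * Real.pi) - (c₁ + c₂ + 49) * (K:ℝ) ^ 2 * L ≤ 1 / 2 * E'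
  set ℓ : ℝ := L * Real.log (L / ε) with hℓ
  have hTge' : 2 * ℓ - 49 * K * L ≤ T := by rw [hℓ]; linarith
  have hℓ0 : 0 ≤ ℓ := by
    rw [hℓ]; exact mul_nonneg hL.le (Real.log_nonneg (by rw [le_div_iff₀ hε]; linarith))
  have hKK : (K:ℝ) ≤ (K:ℝ) ^ 2 := by
    have := mul_le_mul_of_nonneg_left (show (1:ℝ) ≤ K by linarith) hK0.le
    rw [mul_one] at this; rw [sq]; exact this
  have hKL : (K:ℝ) * L ≤ (K:ℝ) ^ 2 * L := mul_le_mul_of_nonneg_right hKK hL.le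
  have hKL0 : 0 ≤ (K:ℝ) * L := by positivity
  have hX0 : 0 ≤ (K:ℝ) ^ 2 * L := by positivity
  have h4π : (1:ℝ) ≤ 4 * Real.pi := by linarith
  clear_value ξ T A Q E' M ℓ
  -- it suffices to bound `ℓ` by `4π (E'/2 + C K² L)`
  suffices hmain : ℓ ≤ 2 * Real.pi * E' + 4 * Real.pi * ((c₁ + c₂ + 49) * (K:ℝ) ^ 2 * L) by
    rw [sub_le_iff_le_add, div_le_iff₀ (by positivity)]
    have : 2 * Real.pi * E' + 4 * Real.pi * ((c₁ + c₂ + 49) * (K:ℝ) ^ 2 * L) =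
        (1 / 2 * E' + (c₁ + c₂ + 49) * (K:ℝ) ^ 2 * L) * (4 * Real.pi) := by ring
    linarith
  have hE'π : 0 ≤ 2 * Real.pi * E' := by positivity
  by_cases hA0 : T - c₁ * K * L ≤ 0
  · -- trivial case: the logarithm is dominated by `K L`
    have h1 : 2 * ℓ ≤ (c₁ + 49) * (K * L) := by linarith
    have h2 : (c₁ + 49) * (K * L) ≤ (c₁ + 49) * ((K:ℝ) ^ 2 * L) :=
      mul_le_mul_of_nonneg_left hKL (by positivity)
    have h3 : (c₁ + 49) * ((K:ℝ) ^ 2 * L) ≤ 4 * Real.pi * ((c₁ + c₂ + 49) * (K:ℝ) ^ 2 * L) := by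
      have hc : c₁ + 49 ≤ 4 * Real.pi * (c₁ + c₂ + 49) := by
        calc c₁ + 49 ≤ 1 * (c₁ + c₂ + 49) := by linarith
          _ ≤ 4 * Real.pi * (c₁ + c₂ + 49) := mul_le_mul_of_nonneg_right h4π (by positivity)
      have := mul_le_mul_of_nonneg_right hc hX0
      linarith [this]
    linarith
  · push Not at hA0
    have hA0' : 0 < A := hA0.trans_le hAge
    have hQpos : 0 < Q := by
      by_contra hq
      have : Q = 0 := le_antisymm (not_lt.1 hq) hQ0
      rw [this, Real.sqrt_zero, mul_zero] at hCS
      linarith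
    set A₀ : ℝ := T - c₁ * K * L with hA₀
    set Qb : ℝ := 4 * Real.pi * T + c₂ * K * L with hQb
    have hQb0 : 0 < Qb := hQpos.trans_le hQle
    -- `E' Q ≥ A₀²`
    have hsq : A₀ ^ 2 ≤ E' * Q := by
      have h1 : A₀ ≤ Real.sqrt E' * Real.sqrt Q := hAge.trans hCS
      calc A₀ ^ 2 ≤ (Real.sqrt E' * Real.sqrt Q) ^ 2 := pow_le_pow_left₀ hA0.le h1 2
        _ = E' * Q := by rw [mul_pow, Real.sq_sqrt hE'0, Real.sq_sqrt hQ0]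
    have hsq' : A₀ ^ 2 ≤ E' * Qb := hsq.trans (mul_le_mul_of_nonneg_left hQle hE'0)
    clear_value A₀ Qb
    -- optimise: `16π² E' ≥ 8π A₀ − Qb`
    have hkey : 8 * Real.pi * A₀ - Qb ≤ 16 * Real.pi ^ 2 * E' := by
      have e1 : Qb * (8 * Real.pi * A₀ - Qb) ≤ 16 * Real.pi ^ 2 * A₀ ^ 2 := by
        have e0 : 16 * Real.pi ^ 2 * A₀ ^ 2 - Qb * (8 * Real.pi * A₀ - Qb) =
            (4 * Real.pi * A₀ - Qb) ^ 2 := by ring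
        linarith [sq_nonneg (4 * Real.pi * A₀ - Qb), e0]
      have e2 : 16 * Real.pi ^ 2 * A₀ ^ 2 ≤ Qb * (16 * Real.pi ^ 2 * E') := by
        have := mul_le_mul_of_nonneg_left hsq' (by positivity : (0:ℝ) ≤ 16 * Real.pi ^ 2)
        linarith [this]
      exact le_of_mul_le_mul_left (e1.trans e2) hQb0
    -- conclude
    have h4 : 4 * Real.pi * (2 * ℓ - 49 * K * L) ≤ 4 * Real.pi * T :=
      mul_le_mul_of_nonneg_left hTge' (by positivity)
    have hcoef : 196 * Real.pi + 8 * Real.pi * c₁ + c₂ ≤ 32 * Real.pi ^ 2 * (c₁ + c₂ + 49) := by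
      have hππ : Real.pi ≤ Real.pi ^ 2 := by
        calc Real.pi = Real.pi * 1 := (mul_one _).symm
          _ ≤ Real.pi * Real.pi := mul_le_mul_of_nonneg_left (by linarith) (by positivity)
          _ = Real.pi ^ 2 := (sq _).symm
      have hp0 : 0 ≤ Real.pi ^ 2 := sq_nonneg _
      have t1 : 196 * Real.pi ≤ 32 * Real.pi ^ 2 * 49 := by linarith
      have t2 : 8 * Real.pi * c₁ ≤ 32 * Real.pi ^ 2 * c₁ := by
        have : 8 * Real.pi ≤ 32 * Real.pi ^ 2 := by linarith
        exact mul_le_mul_of_nonneg_right this hc₁0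
      have t3 : c₂ ≤ 32 * Real.pi ^ 2 * c₂ := by
        have h1 : (1:ℝ) ≤ 32 * Real.pi ^ 2 := by linarith
        have := mul_le_mul_of_nonneg_right h1 hc₂0
        linarith
      linarith
    have h5 : (196 * Real.pi + 8 * Real.pi * c₁ + c₂) * (K * L) ≤
        32 * Real.pi ^ 2 * (c₁ + c₂ + 49) * ((K:ℝ) ^ 2 * L) :=
      mul_le_mul hcoef hKL hKL0 (by positivity)
    rw [hA₀, hQb] at hkey
    have h6 : 8 * Real.pi * ℓ ≤
        8 * Real.pi * (2 * Real.pi * E' + 4 * Real.pi * ((c₁ + c₂ + 49) * (K:ℝ) ^ 2 * L)) := by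
      linarith [h4, hkey, h5]
    exact le_of_mul_le_mul_left h6 (by positivity)

end VortexFilament

end Literature.Analysis.FluidPDE
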